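import Literature.Computability.QuantumComplexity.PairedCleanXor
import Literature.Computability.QuantumComplexity.ControlledHadamard
import Literature.Computability.QuantumComplexity.ControlledSdagger
import Literature.Computability.Cryptography.KitaevModePhaseEstimation
import Literature.Computability.Cryptography.VanDamSeroussiCubicBlockFunctions
import HarnessLib

/-!
# The quantum block of the cubic Gauss-sum experiment (van Dam–Seroussi, circuit I: layout and gates)

Topic `Literature/Computability/Cryptography`; towards `VanDamSeroussi2002_cubicGaussSumPhase_qsolvable_holds`.
One block of the experiment estimating `G(χ_{p,r})/√p` (van Dam–Seroussi 2002, §4, Algorithm 1 and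
Thm. 1, specialised to the cubic residue character and realised WITHOUT a Fourier transform over
`ℤ/p`: the character state is replaced by the uniform superposition over a coset of cubes, repeated
`L = 2^λ` times with period `p` inside a register of `κ = λ + n + 3` qubits, and the Fourier-basis
read-out of that register is Kitaev's eigenvalue measurement of the increment, §5 of Kitaev 1995):

* `CubicBlock.Layout` — the static sizes `(ℓ, n, λ, B)` (dummy prefix, `p < 2ⁿ`, repetition
  exponent, tests per level and kind) and the wire positions: control `c`, value register `X` (`n`),
  flag `f`, repetition register `J` (`λ`), the constant registers (`p`, `r`, `c'`, `2ⁿ`, `N = 2^κ`,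
  `2B`), the shared work AREA of the five classical blocks, then — in the three-part layout
  `tri` of `KitaevPhaseEstimationCircuit.lean` — the `k = 2Bκ` test wires and the registers `Y`, `P`
  (`κ` each);
* `CubicBlock.mach` — the polynomial-time machines of the five block functions of
  `VanDamSeroussiCubicBlockFunctions.lean` (chosen once from their `CodeFP` certificates);
* `CubicBlock.gates Λ dat` — the gate list: constants by `X` gates; `H` on `c`; controlled `H` on
  `X` (`chLayer`); `PXor[flag → f]`; `H` on `J`; `PXor[x + jp → Y]`; `PXor[split Y → X ++ J]`;
  Kitaev's circuit around `V = PXor[(Y + E(tests)) mod N → P] ++ PXor[(P − E) mod N → Y]`;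
  `S³` on `c` for a sine block; `H` on `c`.

This first file fixes the layout, proves the geometry side conditions of the five `PXor` blocks
(`geom₁` … `geom₅`) and defines the circuit; its semantics is the business of the sequel.
Everything here is proved; definitions have bodies; no named fact is introduced.

## References

* W. van Dam, G. Seroussi, arXiv:quant-ph/0207131 (2002), §4 (Algorithm 1, Thm. 1) [VanDamSeroussi2002].
* A. Yu. Kitaev, arXiv:quant-ph/9511026 (1995), §3 (Lemma 10), §5 [Kitaev1995].
* M. A. Nielsen, I. L. Chuang, CUP 2010, §3.2.5, §4.3, §5.2 [NielsenChuang2010].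
-/

noncomputable section

namespace Literature.Computability.Cryptography

namespace VanDamSeroussi

namespace CubicBlock

open _root_.Computability Complexity QuantumComplexity QuantumComplexity.RevSim QuantumComplexity.RevClean Kitaev1995
open Literature.Computability.Complexity.CodeFP (strE natE bitE pairE)

/-! ### The machines of the block functions -/

/-- A polynomial-time string function together with a machine computing it within the time bound
`Tn e`. [folklore] -/
structure Mach where
  /-- the function -/
  fn : List Bool → List Bool
  /-- the time exponent -/
  e : ℕ
  /-- the machine -/
  M : Turing.TM2ComputableAux Bool Bool
  /-- the machine computes the function in time -/
  spec : ∀ u : List Bool, M.OutputsWithin u (fn u) (Tn e u.length)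

/-- The machine of a polynomial-time function (a choice). [cite: AroraBarak2009, §1.3] -/
def Mach.ofFP (fn : List Bool → List Bool) (h : fn ∈ FP) : Mach :=
  ⟨fn, Classical.choose (exists_outputsWithin_pow_of_mem_FP h),
    Classical.choose (Classical.choose_spec (exists_outputsWithin_pow_of_mem_FP h)),
    Classical.choose_spec (Classical.choose_spec (exists_outputsWithin_pow_of_mem_FP h))⟩

/-- The machine of a `CodeFP` certificate (a choice of the string function, then of the machine). [folklore] -/
def Mach.ofCodeFP {α β : Type} {eα : α → List Bool} {eβ : β → List Bool} {g : α → β} (h : CodeFP eα eβ g) : Mach :=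
  Mach.ofFP (Classical.choose h) (Classical.choose_spec h).1

/-- The function of the machine of a certificate computes `g` on codes. [folklore] -/
theorem Mach.ofCodeFP_fn {α β : Type} {eα : α → List Bool} {eβ : β → List Bool} {g : α → β} (h : CodeFP eα eβ g)
    (a : α) : (Mach.ofCodeFP h).fn (eα a) = eβ (g a) :=
  (Classical.choose_spec h).2 a

/-- The flag machine. [folklore] -/
def mach₁ : Mach := Mach.ofCodeFP codeFP_flagVal
/-- The repetition machine. [folklore] -/
def mach₂ : Mach := Mach.ofCodeFP codeFP_combineVal
/-- The splitting machine. [folklore] -/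
def mach₃ : Mach := Mach.ofCodeFP codeFP_splitVal
/-- The move-and-add machine. [folklore] -/
def mach₄ : Mach := Mach.ofCodeFP codeFP_peAddVal
/-- The un-move machine. [folklore] -/
def mach₅ : Mach := Mach.ofCodeFP codeFP_peSubVal

/-! ### The layout -/

/-- The static sizes of a block. [folklore] -/
structure Layout where
  /-- `p < 2ⁿ`; the input `x' = bits of p ++ bits of r` occupies the wires `[0, 2n)` -/
  n : ℕ
  /-- `L = 2^λ` repetitions -/
  lam : ℕ
  /-- tests per level and kind -/
  B : ℕ

namespace Layout

variable (Λ : Layout)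

/-- The input width: `n` bits of `p`, then `n` bits of `r`. [folklore] -/
def ℓ : ℕ := 2 * Λ.n

/-- `κ = λ + n + 3` (`N = 2^κ > 8pL`). [folklore] -/
def kap : ℕ := Λ.lam + Λ.n + 3
/-- `N = 2^κ`. [folklore] -/
def Nmod : ℕ := 2 ^ Λ.kap
/-- Tests per level: `B` cosine, `B` sine. [folklore] -/
def Bper : ℕ := 2 * Λ.B
/-- Number of test wires: `κ` levels. [folklore] -/
def k : ℕ := Λ.kap * Λ.Bper
/-- Width of the constant register holding `2B`. [folklore] -/
def wB : ℕ := Λ.Bper + 1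

/-- The coin switching the sine test on the control (`τ`). [folklore] -/
def tau : ℕ := Λ.ℓ
/-- The control qubit. [folklore] -/
def c : ℕ := Λ.ℓ + 1
/-- The value register `X`. [folklore] -/
def X (i : ℕ) : ℕ := Λ.ℓ + 2 + i
/-- The flag. [folklore] -/
def f : ℕ := Λ.ℓ + 2 + Λ.n
/-- The repetition register `J`. [folklore] -/
def J (i : ℕ) : ℕ := Λ.ℓ + 3 + Λ.n + i
/-- Start of the constants. [folklore] -/
def cs : ℕ := Λ.ℓ + 3 + Λ.n + Λ.lam
/-- The input register holding `p`: the first `n` input wires. [folklore] -/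
def Preg (_Λ : Layout) (i : ℕ) : ℕ := i
/-- The input register holding `r`: the next `n` input wires. [folklore] -/
def Rreg (i : ℕ) : ℕ := Λ.n + i
/-- The two coin wires holding the coset index `c'` (in uniform superposition). [folklore] -/
def CPreg (i : ℕ) : ℕ := Λ.cs + i
/-- The register holding `2ⁿ`. [folklore] -/
def T2n (i : ℕ) : ℕ := Λ.cs + 2 + i
/-- The register holding `N = 2^κ`. [folklore] -/
def Nreg (i : ℕ) : ℕ := Λ.cs + Λ.n + 3 + i
/-- The register holding `2B`. [folklore] -/
def BPreg (i : ℕ) : ℕ := Λ.cs + Λ.n + Λ.kap + 4 + i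
/-- Start of the shared work area. [folklore] -/
def as : ℕ := Λ.cs + Λ.n + Λ.kap + 4 + Λ.wB

/-- The lengths of the data areas of the five blocks (pair format: a non-last field of width `w`
takes `2w + 2` wires, the last one `w`). [folklore] -/
def slotsLen : List ℕ → ℕ
  | [] => 0
  | [w] => w
  | w :: w' :: ws => 2 * w + 2 + slotsLen (w' :: ws)

/-- Data-area length of the flag block. [folklore] -/
def aLen₁ : ℕ := slotsLen [1, Λ.n, Λ.n, Λ.n, 2]
/-- Data-area length of the repetition block. [folklore] -/
def aLen₂ : ℕ := slotsLen [Λ.n, Λ.lam, Λ.n]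
/-- Data-area length of the splitting block. [folklore] -/
def aLen₃ : ℕ := slotsLen [Λ.kap, Λ.n, Λ.n + 1]
/-- Data-area length of the two blocks of the eigenvalue measurement. [folklore] -/
def aLen₄ : ℕ := slotsLen [Λ.kap, Λ.k, Λ.kap + 1, Λ.wB]

/-- The top of the work area: room for each of the five blocks. [folklore] -/
def aTop : ℕ := Λ.as + (width mach₁.e mach₁.M Λ.aLen₁ + width mach₂.e mach₂.M Λ.aLen₂ + width mach₃.e mach₃.M Λ.aLen₃ +
  width mach₄.e mach₄.M Λ.aLen₄ + width mach₅.e mach₅.M Λ.aLen₄)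

/-- The size of the first part of the three-part layout (everything before the tests). [folklore] -/
def n₁ : ℕ := Λ.aTop
/-- Test wire `i`. [folklore] -/
def tst (i : ℕ) : ℕ := Λ.n₁ + i
/-- The repeated register `Y`. [folklore] -/
def Y (i : ℕ) : ℕ := Λ.n₁ + Λ.k + i
/-- The target register `P` of the move. [folklore] -/
def P (i : ℕ) : ℕ := Λ.n₁ + Λ.k + Λ.kap + i
/-- The total width (reducible: the three-part layout `n₁ + (k + (κ + κ))` of Kitaev's circuit). [folklore] -/
abbrev Wd : ℕ := Λ.n₁ + (Λ.k + (Λ.kap + Λ.kap))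

/-- The total width is positive. [folklore] -/
theorem Wd_pos : 0 < Λ.Wd := by unfold Wd n₁ aTop as cs; omega

/-! ### The fields of the five blocks -/

/-- A register as a list of wires. [folklore] -/
def reg (pos : ℕ → ℕ) (w : ℕ) : List ℕ := (List.range w).map pos

/-- Registers given by (position map, width). [folklore] -/
def regs (ps : List ((ℕ → ℕ) × ℕ)) : List (List ℕ) := ps.map fun q => reg q.1 q.2

/-- Fields of the flag block: `[c], X, p, r, c'`. [folklore] -/
def ps₁ : List ((ℕ → ℕ) × ℕ) := [(fun _ => Λ.c, 1), (Λ.X, Λ.n), (Λ.Preg, Λ.n), (Λ.Rreg, Λ.n), (Λ.CPreg, 2)]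
/-- Fields of the repetition block: `X, J, p`. [folklore] -/
def ps₂ : List ((ℕ → ℕ) × ℕ) := [(Λ.X, Λ.n), (Λ.J, Λ.lam), (Λ.Preg, Λ.n)]
/-- Fields of the splitting block: `Y, p, 2ⁿ`. [folklore] -/
def ps₃ : List ((ℕ → ℕ) × ℕ) := [(Λ.Y, Λ.kap), (Λ.Preg, Λ.n), (Λ.T2n, Λ.n + 1)]
/-- Fields of the move-and-add block: `Y, tests, N, 2B`. [folklore] -/
def ps₄ : List ((ℕ → ℕ) × ℕ) := [(Λ.Y, Λ.kap), (Λ.tst, Λ.k), (Λ.Nreg, Λ.kap + 1), (Λ.BPreg, Λ.wB)]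
/-- Fields of the un-move block: `P, tests, N, 2B`. [folklore] -/
def ps₅ : List ((ℕ → ℕ) × ℕ) := [(Λ.P, Λ.kap), (Λ.tst, Λ.k), (Λ.Nreg, Λ.kap + 1), (Λ.BPreg, Λ.wB)]

/-- Fields of the flag block. [folklore] -/
abbrev fs₁ : List (List ℕ) := regs Λ.ps₁
/-- Fields of the repetition block. [folklore] -/
abbrev fs₂ : List (List ℕ) := regs Λ.ps₂
/-- Fields of the splitting block. [folklore] -/
abbrev fs₃ : List (List ℕ) := regs Λ.ps₃
/-- Fields of the move-and-add block. [folklore] -/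
abbrev fs₄ : List (List ℕ) := regs Λ.ps₄
/-- Fields of the un-move block. [folklore] -/
abbrev fs₅ : List (List ℕ) := regs Λ.ps₅

/-- Targets of the splitting block: `X`, then `J`. [folklore] -/
def tXJ (j : ℕ) : ℕ := if j < Λ.n then Λ.X j else Λ.J (j - Λ.n)

/-- Membership in a register. [folklore] -/
theorem mem_reg {pos : ℕ → ℕ} {w s : ℕ} : s ∈ reg pos w ↔ ∃ i, i < w ∧ pos i = s := by
  simp [reg, List.mem_map, List.mem_range]

/-- A property of all source wires of `regs ps`. [folklore] -/
theorem forall_regs {ps : List ((ℕ → ℕ) × ℕ)} {Q : ℕ → Prop} :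
    (∀ f ∈ regs ps, ∀ s ∈ f, Q s) ↔ ∀ q ∈ ps, ∀ i, i < q.2 → Q (q.1 i) := by
  constructor
  · intro h q hq i hi
    exact h _ (List.mem_map.2 ⟨q, hq, rfl⟩) _ (mem_reg.2 ⟨i, hi, rfl⟩)
  · intro h f hf s hs
    obtain ⟨q, hq, rfl⟩ := List.mem_map.1 hf
    obtain ⟨i, hi, rfl⟩ := mem_reg.1 hs
    exact h q hq i hi

/-- Two template slots per source wire. [folklore] -/
theorem sum_map_length_pair (l : List ℕ) :
    (l.map fun a => ([Sum.inl a, Sum.inl a] : List (ℕ ⊕ Bool)).length).sum = 2 * l.length := by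
  induction l with
  | nil => rfl
  | cons a l ih =>
    rw [List.map_cons, List.sum_cons, ih]
    simp only [List.length_cons, List.length_nil]
    omega

/-- The length of the template of fields of given widths. [folklore] -/
theorem length_slots_regs (ps : List ((ℕ → ℕ) × ℕ)) : (PXor.slots (regs ps)).length = slotsLen (ps.map Prod.snd) := by
  unfold regs
  induction ps with
  | nil => rfl
  | cons q ps ih =>
    cases ps with
    | nil => simp [PXor.slots, slotsLen, reg]
    | cons q' ps =>
      simp only [List.map_cons] at ih ⊢
      rw [PXor.slots, slotsLen, List.length_append, List.length_append, ih, List.length_flatMap, sum_map_length_pair]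
      simp only [reg, List.length_map, List.length_range, List.length_cons, List.length_nil]

/-- Data-area lengths of the five blocks. [folklore] -/
theorem length_slots_fs :
    (PXor.slots Λ.fs₁).length = Λ.aLen₁ ∧ (PXor.slots Λ.fs₂).length = Λ.aLen₂ ∧ (PXor.slots Λ.fs₃).length = Λ.aLen₃ ∧
      (PXor.slots Λ.fs₄).length = Λ.aLen₄ ∧ (PXor.slots Λ.fs₅).length = Λ.aLen₄ := by
  refine ⟨?_, ?_, ?_, ?_, ?_⟩ <;> simp [length_slots_regs, ps₁, ps₂, ps₃, ps₄, ps₅, aLen₁, aLen₂, aLen₃, aLen₄]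

/-- Closed forms of the data-area lengths. [folklore] -/
theorem aLen_eq : Λ.aLen₁ = 6 * Λ.n + 12 ∧ Λ.aLen₂ = 3 * Λ.n + 2 * Λ.lam + 4 ∧ Λ.aLen₃ = 2 * Λ.kap + 3 * Λ.n + 5 ∧
    Λ.aLen₄ = 4 * Λ.kap + 2 * Λ.k + Λ.wB + 8 := by
  simp only [aLen₁, aLen₂, aLen₃, aLen₄, slotsLen]; omega

/-! ### Position facts -/

section Pos

/-- `τ` is before the control, which is before the area. [folklore] -/
theorem tau_lt_c : Λ.tau < Λ.c := by simp only [tau, c]; omega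
/-- `c` is before the area. [folklore] -/
theorem c_lt_as : Λ.c < Λ.as := by simp only [c, as, cs]; omega
/-- `X` is before the area. [folklore] -/
theorem X_lt_as {i : ℕ} (hi : i < Λ.n) : Λ.X i < Λ.as := by simp only [X, as, cs]; omega
/-- `f` is before the area. [folklore] -/
theorem f_lt_as : Λ.f < Λ.as := by simp only [f, as, cs]; omega
/-- `J` is before the area. [folklore] -/
theorem J_lt_as {i : ℕ} (hi : i < Λ.lam) : Λ.J i < Λ.as := by simp only [J, as, cs]; omega
/-- `p` is before the area. [folklore] -/
theorem Preg_lt_as {i : ℕ} (hi : i < Λ.n) : Λ.Preg i < Λ.as := by simp only [Preg, as, cs, ℓ]; omega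
/-- `r` is before the area. [folklore] -/
theorem Rreg_lt_as {i : ℕ} (hi : i < Λ.n) : Λ.Rreg i < Λ.as := by simp only [Rreg, as, cs]; omega
/-- `c'` is before the area. [folklore] -/
theorem CPreg_lt_as {i : ℕ} (hi : i < 2) : Λ.CPreg i < Λ.as := by simp only [CPreg, as, cs]; omega
/-- `2ⁿ` is before the area. [folklore] -/
theorem T2n_lt_as {i : ℕ} (hi : i < Λ.n + 1) : Λ.T2n i < Λ.as := by simp only [T2n, as, cs]; omega
/-- `N` is before the area. [folklore] -/
theorem Nreg_lt_as {i : ℕ} (hi : i < Λ.kap + 1) : Λ.Nreg i < Λ.as := by simp only [Nreg, as, cs]; omega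
/-- `2B` is before the area. [folklore] -/
theorem BPreg_lt_as {i : ℕ} (hi : i < Λ.wB) : Λ.BPreg i < Λ.as := by simp only [BPreg, as]; omega
/-- The area is inside the first part. [folklore] -/
theorem as_le_n₁ : Λ.as ≤ Λ.n₁ := by simp only [n₁, aTop]; omega
/-- The tests follow the first part. [folklore] -/
theorem n₁_le_tst (i : ℕ) : Λ.n₁ ≤ Λ.tst i := by simp only [tst]; omega
/-- `Y` follows the first part. [folklore] -/
theorem n₁_le_Y (i : ℕ) : Λ.n₁ ≤ Λ.Y i := by simp only [Y]; omega
/-- `P` follows the first part. [folklore] -/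
theorem n₁_le_P (i : ℕ) : Λ.n₁ ≤ Λ.P i := by simp only [P]; omega
/-- The tests are inside the register. [folklore] -/
theorem tst_lt_Wd {i : ℕ} (hi : i < Λ.k) : Λ.tst i < Λ.Wd := by simp only [tst, Wd]; omega
/-- `Y` is inside the register. [folklore] -/
theorem Y_lt_Wd {i : ℕ} (hi : i < Λ.kap) : Λ.Y i < Λ.Wd := by simp only [Y, Wd]; omega
/-- `P` is inside the register. [folklore] -/
theorem P_lt_Wd {i : ℕ} (hi : i < Λ.kap) : Λ.P i < Λ.Wd := by simp only [P, Wd]; omega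
/-- The first part is inside the register. [folklore] -/
theorem n₁_le_Wd : Λ.n₁ ≤ Λ.Wd := by simp only [Wd]; omega

end Pos

/-! ### Geometry of the five blocks -/

section Geom

open PXor (SrcOff)

/-- `n ≤ JJ e M n`. [folklore] -/
theorem le_JJ (e : ℕ) (M : Turing.TM2ComputableAux Bool Bool) (n : ℕ) : n ≤ JJ e M n := by
  unfold JJ RevSim.Sn; omega

/-- The data length is at most the width of the block. [folklore] -/
theorem le_width' (e : ℕ) (M : Turing.TM2ComputableAux Bool Bool) (n : ℕ) : n ≤ width e M n :=
  (le_NN (e := e) (M := M) n).trans (NN_le_width n)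

/-- The top of a block with data area of length `len` at `as`. [folklore] -/
theorem top_eq {e : ℕ} {M : Turing.TM2ComputableAux Bool Bool} {fs : List (List ℕ)} {len : ℕ}
    (h : (PXor.slots fs).length = len) : PXor.top e M Λ.as fs = Λ.as + width e M len := by
  have hw := le_width' e M len
  simp only [PXor.top, CleanPlaced.top, h, List.length_nil, Nat.add_zero]
  omega

/-- The five tops are inside the first part. [folklore] -/
theorem tops_le : Λ.as + width mach₁.e mach₁.M Λ.aLen₁ ≤ Λ.n₁ ∧ Λ.as + width mach₂.e mach₂.M Λ.aLen₂ ≤ Λ.n₁ ∧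
    Λ.as + width mach₃.e mach₃.M Λ.aLen₃ ≤ Λ.n₁ ∧ Λ.as + width mach₄.e mach₄.M Λ.aLen₄ ≤ Λ.n₁ ∧
    Λ.as + width mach₅.e mach₅.M Λ.aLen₄ ≤ Λ.n₁ := by
  simp only [n₁, aTop]; omega

/-- Geometry of the flag block (target `f`). [folklore] -/
theorem geom₁ : PXor.GeomOK Λ.Wd mach₁.e mach₁.M Λ.as Λ.fs₁ 1 (fun _ => Λ.f) := by
  have htop := Λ.top_eq (e := mach₁.e) (M := mach₁.M) Λ.length_slots_fs.1
  have ht := Λ.tops_le.1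
  have h1 := Λ.as_le_n₁; have h2 := Λ.n₁_le_Wd; have h3 := Λ.f_lt_as; have h4 := Λ.c_lt_as
  have hlen := Λ.aLen_eq.1
  refine ⟨by omega, ?_, ?_, fun _ _ => by omega, fun _ _ _ _ _ => by omega, fun _ _ => Or.inl h3, ?_, ?_⟩
  · refine forall_regs.2 fun q hq i hi => ?_
    simp only [ps₁, List.mem_cons, List.not_mem_nil, or_false] at hq
    rcases hq with rfl | rfl | rfl | rfl | rfl <;> simp only at hi ⊢
    · omega
    · have := Λ.X_lt_as hi; omega
    · have := Λ.Preg_lt_as hi; omega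
    · have := Λ.Rreg_lt_as hi; omega
    · have := Λ.CPreg_lt_as hi; omega
  · refine forall_regs.2 fun q hq i hi => Or.inl ?_
    simp only [ps₁, List.mem_cons, List.not_mem_nil, or_false] at hq
    rcases hq with rfl | rfl | rfl | rfl | rfl <;> simp only at hi ⊢
    · omega
    · exact Λ.X_lt_as hi
    · exact Λ.Preg_lt_as hi
    · exact Λ.Rreg_lt_as hi
    · exact Λ.CPreg_lt_as hi
  · intro j hj
    refine fun f' hf' hmem => ?_
    have key : ∀ q ∈ Λ.ps₁, ∀ i, i < q.2 → q.1 i ≠ Λ.f := by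
      intro q hq i hi
      simp only [ps₁, List.mem_cons, List.not_mem_nil, or_false] at hq
      rcases hq with rfl | rfl | rfl | rfl | rfl <;> simp only at hi ⊢ <;> simp only [c, X, f, Preg, Rreg, CPreg, cs, ℓ] <;> omega
    exact (forall_regs (Q := fun s => s ≠ Λ.f)).2 key f' hf' _ hmem rfl
  · simp only [Λ.length_slots_fs.1]
    have := le_JJ mach₁.e mach₁.M Λ.aLen₁; omega

/-- Geometry of the repetition block (targets `Y`). [folklore] -/
theorem geom₂ : PXor.GeomOK Λ.Wd mach₂.e mach₂.M Λ.as Λ.fs₂ Λ.kap Λ.Y := by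
  have htop := Λ.top_eq (e := mach₂.e) (M := mach₂.M) Λ.length_slots_fs.2.1
  have ht := Λ.tops_le.2.1
  have h1 := Λ.as_le_n₁; have h2 := Λ.n₁_le_Wd
  have hlen := Λ.aLen_eq.2.1
  have hkap : Λ.kap = Λ.lam + Λ.n + 3 := rfl
  refine ⟨by omega, ?_, ?_, fun j hj => Λ.Y_lt_Wd hj, fun j j' _ _ h => by simp only [Y] at h; omega,
    fun j _ => Or.inr (by have := Λ.n₁_le_Y j; omega), ?_, ?_⟩
  · refine forall_regs.2 fun q hq i hi => ?_
    simp only [ps₂, List.mem_cons, List.not_mem_nil, or_false] at hq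
    rcases hq with rfl | rfl | rfl <;> simp only at hi ⊢
    · have := Λ.X_lt_as hi; omega
    · have := Λ.J_lt_as hi; omega
    · have := Λ.Preg_lt_as hi; omega
  · refine forall_regs.2 fun q hq i hi => Or.inl ?_
    simp only [ps₂, List.mem_cons, List.not_mem_nil, or_false] at hq
    rcases hq with rfl | rfl | rfl <;> simp only at hi ⊢
    · exact Λ.X_lt_as hi
    · exact Λ.J_lt_as hi
    · exact Λ.Preg_lt_as hi
  · intro j hj f' hf' hmem
    have hY := Λ.n₁_le_Y j
    have key : ∀ q ∈ Λ.ps₂, ∀ i, i < q.2 → q.1 i ≠ Λ.Y j := by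
      intro q hq i hi
      simp only [ps₂, List.mem_cons, List.not_mem_nil, or_false] at hq
      rcases hq with rfl | rfl | rfl <;> simp only at hi ⊢
      · have := Λ.X_lt_as hi; omega
      · have := Λ.J_lt_as hi; omega
      · have := Λ.Preg_lt_as hi; omega
    exact (forall_regs (Q := fun s => s ≠ Λ.Y j)).2 key f' hf' _ hmem rfl
  · simp only [Λ.length_slots_fs.2.1]
    have := le_JJ mach₂.e mach₂.M Λ.aLen₂; omega

/-- Geometry of the splitting block (targets `X`, then `J`). [folklore] -/
theorem geom₃ : PXor.GeomOK Λ.Wd mach₃.e mach₃.M Λ.as Λ.fs₃ (Λ.n + Λ.lam) Λ.tXJ := by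
  have htop := Λ.top_eq (e := mach₃.e) (M := mach₃.M) Λ.length_slots_fs.2.2.1
  have ht := Λ.tops_le.2.2.1
  have h1 := Λ.as_le_n₁; have h2 := Λ.n₁_le_Wd
  have hlen := Λ.aLen_eq.2.2.1
  have hkap : Λ.kap = Λ.lam + Λ.n + 3 := rfl
  have htlt : ∀ j, j < Λ.n + Λ.lam → Λ.tXJ j < Λ.as := fun j hj => by
    unfold tXJ; split_ifs with h
    · exact Λ.X_lt_as h
    · exact Λ.J_lt_as (by omega)
  refine ⟨by omega, ?_, ?_, fun j hj => by have := htlt j hj; omega, fun j j' hj hj' h => ?_,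
    fun j hj => Or.inl (htlt j hj), ?_, ?_⟩
  · refine forall_regs.2 fun q hq i hi => ?_
    simp only [ps₃, List.mem_cons, List.not_mem_nil, or_false] at hq
    rcases hq with rfl | rfl | rfl <;> simp only at hi ⊢
    · exact Λ.Y_lt_Wd hi
    · have := Λ.Preg_lt_as hi; omega
    · have := Λ.T2n_lt_as hi; omega
  · refine forall_regs.2 fun q hq i hi => ?_
    simp only [ps₃, List.mem_cons, List.not_mem_nil, or_false] at hq
    rcases hq with rfl | rfl | rfl <;> simp only at hi ⊢
    · exact Or.inr (by have := Λ.n₁_le_Y i; omega)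
    · exact Or.inl (Λ.Preg_lt_as hi)
    · exact Or.inl (Λ.T2n_lt_as hi)
  · revert h; unfold tXJ; split_ifs <;> simp only [X, J] <;> omega
  · intro j hj f' hf' hmem
    have key : ∀ q ∈ Λ.ps₃, ∀ i, i < q.2 → q.1 i ≠ Λ.tXJ j := by
      intro q hq i hi
      have ht' := htlt j hj
      simp only [ps₃, List.mem_cons, List.not_mem_nil, or_false] at hq
      rcases hq with rfl | rfl | rfl <;> simp only at hi ⊢
      · have := Λ.n₁_le_Y i; omega
      · revert ht'; unfold tXJ; split_ifs <;> simp only [X, J, Preg, cs, as, ℓ] <;> omega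
      · revert ht'; unfold tXJ; split_ifs <;> simp only [X, J, T2n, cs, as, ℓ] <;> omega
    exact (forall_regs (Q := fun s => s ≠ Λ.tXJ j)).2 key f' hf' _ hmem rfl
  · simp only [Λ.length_slots_fs.2.2.1]
    have := le_JJ mach₃.e mach₃.M Λ.aLen₃; omega

/-- Geometry of the move-and-add block (targets `P`). [folklore] -/
theorem geom₄ : PXor.GeomOK Λ.Wd mach₄.e mach₄.M Λ.as Λ.fs₄ Λ.kap Λ.P := by
  have htop := Λ.top_eq (e := mach₄.e) (M := mach₄.M) Λ.length_slots_fs.2.2.2.1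
  have ht := Λ.tops_le.2.2.2.1
  have h1 := Λ.as_le_n₁; have h2 := Λ.n₁_le_Wd
  have hlen := Λ.aLen_eq.2.2.2
  refine ⟨by omega, ?_, ?_, fun j hj => Λ.P_lt_Wd hj, fun j j' _ _ h => by simp only [P] at h; omega,
    fun j _ => Or.inr (by have := Λ.n₁_le_P j; omega), ?_, ?_⟩
  · refine forall_regs.2 fun q hq i hi => ?_
    simp only [ps₄, List.mem_cons, List.not_mem_nil, or_false] at hq
    rcases hq with rfl | rfl | rfl | rfl <;> simp only at hi ⊢
    · exact Λ.Y_lt_Wd hi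
    · exact Λ.tst_lt_Wd hi
    · have := Λ.Nreg_lt_as hi; omega
    · have := Λ.BPreg_lt_as hi; omega
  · refine forall_regs.2 fun q hq i hi => ?_
    simp only [ps₄, List.mem_cons, List.not_mem_nil, or_false] at hq
    rcases hq with rfl | rfl | rfl | rfl <;> simp only at hi ⊢
    · exact Or.inr (by have := Λ.n₁_le_Y i; omega)
    · exact Or.inr (by have := Λ.n₁_le_tst i; omega)
    · exact Or.inl (Λ.Nreg_lt_as hi)
    · exact Or.inl (Λ.BPreg_lt_as hi)
  · intro j hj f' hf' hmem
    have key : ∀ q ∈ Λ.ps₄, ∀ i, i < q.2 → q.1 i ≠ Λ.P j := by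
      intro q hq i hi
      simp only [ps₄, List.mem_cons, List.not_mem_nil, or_false] at hq
      rcases hq with rfl | rfl | rfl | rfl <;> simp only at hi ⊢
      · simp only [Y, P]; omega
      · simp only [tst, P]; omega
      · have := Λ.Nreg_lt_as hi; have := Λ.n₁_le_P j; omega
      · have := Λ.BPreg_lt_as hi; have := Λ.n₁_le_P j; omega
    exact (forall_regs (Q := fun s => s ≠ Λ.P j)).2 key f' hf' _ hmem rfl
  · simp only [Λ.length_slots_fs.2.2.2.1]
    have := le_JJ mach₄.e mach₄.M Λ.aLen₄; omega

/-- Geometry of the un-move block (targets `Y`). [folklore] -/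
theorem geom₅ : PXor.GeomOK Λ.Wd mach₅.e mach₅.M Λ.as Λ.fs₅ Λ.kap Λ.Y := by
  have htop := Λ.top_eq (e := mach₅.e) (M := mach₅.M) Λ.length_slots_fs.2.2.2.2
  have ht := Λ.tops_le.2.2.2.2
  have h1 := Λ.as_le_n₁; have h2 := Λ.n₁_le_Wd
  have hlen := Λ.aLen_eq.2.2.2
  refine ⟨by omega, ?_, ?_, fun j hj => Λ.Y_lt_Wd hj, fun j j' _ _ h => by simp only [Y] at h; omega,
    fun j _ => Or.inr (by have := Λ.n₁_le_Y j; omega), ?_, ?_⟩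
  · refine forall_regs.2 fun q hq i hi => ?_
    simp only [ps₅, List.mem_cons, List.not_mem_nil, or_false] at hq
    rcases hq with rfl | rfl | rfl | rfl <;> simp only at hi ⊢
    · exact Λ.P_lt_Wd hi
    · exact Λ.tst_lt_Wd hi
    · have := Λ.Nreg_lt_as hi; omega
    · have := Λ.BPreg_lt_as hi; omega
  · refine forall_regs.2 fun q hq i hi => ?_
    simp only [ps₅, List.mem_cons, List.not_mem_nil, or_false] at hq
    rcases hq with rfl | rfl | rfl | rfl <;> simp only at hi ⊢
    · exact Or.inr (by have := Λ.n₁_le_P i; omega)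
    · exact Or.inr (by have := Λ.n₁_le_tst i; omega)
    · exact Or.inl (Λ.Nreg_lt_as hi)
    · exact Or.inl (Λ.BPreg_lt_as hi)
  · intro j hj f' hf' hmem
    have key : ∀ q ∈ Λ.ps₅, ∀ i, i < q.2 → q.1 i ≠ Λ.Y j := by
      intro q hq i hi
      simp only [ps₅, List.mem_cons, List.not_mem_nil, or_false] at hq
      rcases hq with rfl | rfl | rfl | rfl <;> simp only at hi ⊢
      · simp only [Y, P]; omega
      · simp only [tst, Y]; omega
      · have := Λ.Nreg_lt_as hi; have := Λ.n₁_le_Y j; omega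
      · have := Λ.BPreg_lt_as hi; have := Λ.n₁_le_Y j; omega
    exact (forall_regs (Q := fun s => s ≠ Λ.Y j)).2 key f' hf' _ hmem rfl
  · simp only [Λ.length_slots_fs.2.2.2.2]
    have := le_JJ mach₅.e mach₅.M Λ.aLen₄; omega

end Geom

/-! ### The circuit -/

section Circuit

/-- Wires of the block register by position. [folklore] -/
def fin (i : ℕ) : Fin Λ.Wd := finOf Λ.Wd Λ.Wd_pos i

/-- The data of a block COMPONENT: the prime `p` and the primitive root `r` (on the input wires) and
the values of the coins — the coset index `c'` and the kind of the test on the control (`true` = sine)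
— in the component. [folklore] -/
structure Data where
  /-- the prime -/
  p : ℕ
  /-- the primitive root -/
  r : ℕ
  /-- the coset index (value of the two coin wires `CPreg`) -/
  cp : ℕ
  /-- sine test on the control qubit (value of the coin wire `τ`) -/
  im : Bool

/-- The `w` low bits of `v`, little-endian. [folklore] -/
def bitsLE (v w : ℕ) : List Bool := (List.range w).map fun i => v.testBit i

/-- The `X` gates writing the constants `2ⁿ, N, 2B` into their registers (`p` and `r` are the input). [folklore] -/
def constOps : List (ClOp ℕ) :=
  notsV (Λ.T2n 0) (bitsLE (2 ^ Λ.n) (Λ.n + 1)) ++ notsV (Λ.Nreg 0) (bitsLE Λ.Nmod (Λ.kap + 1)) ++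
    notsV (Λ.BPreg 0) (bitsLE Λ.Bper Λ.wB)

/-- The wires of the constant gates are below the area. [folklore] -/
theorem constOps_lt : ∀ op ∈ Λ.constOps, ∀ i ∈ wiresOf op, i < Λ.Wd := by
  intro op hop i hi
  have h1 := Λ.as_le_n₁; have h2 := Λ.n₁_le_Wd
  have hmem : ∀ {n₀ : ℕ} {v : List Bool}, op ∈ notsV n₀ v → i = op.target ∧ op.target < n₀ + v.length := fun h => by
    unfold notsV at h
    rw [List.mem_map] at h
    obtain ⟨j, hj, rfl⟩ := h
    rw [List.mem_filter, List.mem_range] at hj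
    simp only [mem_wiresOf, ClOp.target, ClOp.controls, List.not_mem_nil, or_false] at hi
    exact ⟨hi, by simp only [ClOp.target]; omega⟩
  have has : Λ.as = Λ.cs + Λ.n + Λ.kap + 4 + Λ.wB := rfl
  simp only [constOps, List.mem_append] at hop
  rcases hop with (h | h) | h <;> obtain ⟨rfl, hlt⟩ := hmem h <;>
    simp only [bitsLE, List.length_map, List.length_range, T2n, Nreg, BPreg] at hlt ⊢ <;> omega

/-- The constant gates are well formed (`X` gates). [folklore] -/
theorem constOps_wf : ∀ op ∈ Λ.constOps, op.WF := by
  intro op hop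
  simp only [constOps, List.mem_append] at hop
  rcases hop with (h | h) | h <;> exact notsV_wf op h

/-- The constant gates inside the register. [folklore] -/
def constFin : List (ClOp (Fin Λ.Wd)) := Λ.constOps.map (ClOp.map Λ.fin)

/-- The constant gates inside the register are well formed. [folklore] -/
theorem constFin_wf : ∀ op ∈ Λ.constFin, op.WF := by
  intro op hop
  obtain ⟨op', hop', rfl⟩ := List.mem_map.1 hop
  exact wf_map_finOf Λ.Wd_pos (Λ.constOps_lt op' hop') (Λ.constOps_wf op' hop')

/-- The kinds of the tests: within a level, `B` cosine tests then `B` sine tests. [cite: Kitaev1995, §3 Remark 8] -/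
def σ : Fin Λ.k → Bool := fun i => decide (Λ.B ≤ (i : ℕ) % Λ.Bper)

/-- The wires of `X` (the contiguous register `[X 0, X 0 + n)`). [folklore] -/
def Xs : List (Fin Λ.Wd) := (List.range Λ.n).map fun i => Λ.fin (Λ.X 0 + i)

/-- The control is not an `X` wire. [folklore] -/
theorem c_ne_Xs : ∀ a ∈ Λ.Xs, Λ.fin Λ.c ≠ a := by
  intro a ha h
  obtain ⟨i, hi, rfl⟩ := List.mem_map.1 ha
  rw [List.mem_range] at hi
  have h1 := Λ.X_lt_as hi; have h2 := Λ.c_lt_as; have h3 := Λ.as_le_n₁; have h4 := Λ.n₁_le_Wd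
  have hX : Λ.X 0 + i = Λ.X i := by unfold X; omega
  have := congrArg Fin.val h
  rw [fin, fin, val_finOf_of_lt _ (by omega), val_finOf_of_lt _ (by omega)] at this
  have hc : Λ.c < Λ.X 0 := by unfold c X; omega
  omega

/-- Oracle-freeness of a composition. [folklore] -/
theorem isOracleFree_append {N : ℕ} {C D : QCircuit cliffordT N} (hC : C.IsOracleFree) (hD : D.IsOracleFree) :
    (C.append D).IsOracleFree := fun g hg => by
  rcases List.mem_append.1 hg with h | h
  · exact hC g h
  · exact hD g h

/-- **The block of the eigenvalue measurement**: move-and-add `Y → P`, then clear `Y`. [cite: Kitaev1995, §3 Lemma 10] -/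
def V : QCircuit cliffordT Λ.Wd :=
  (PXor.circuit Λ.geom₄ (hN := Λ.Wd_pos)).append (PXor.circuit Λ.geom₅ (hN := Λ.Wd_pos))

/-- `V` is oracle-free. [folklore] -/
theorem V_isOracleFree : Λ.V.IsOracleFree :=
  isOracleFree_append (PXor.circuit_isOracleFree _) (PXor.circuit_isOracleFree _)

/-- `τ` is not the control. [folklore] -/
theorem tau_ne_c : Λ.fin Λ.tau ≠ Λ.fin Λ.c := fun h => by
  have h1 := Λ.tau_lt_c; have h2 := Λ.c_lt_as; have h3 := Λ.as_le_n₁; have h4 := Λ.n₁_le_Wd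
  have := congrArg Fin.val h
  rw [fin, fin, val_finOf_of_lt _ (by omega), val_finOf_of_lt _ (by omega)] at this
  omega

/-- **The constants-and-coins stage**: `X` gates writing `p, r, 2ⁿ, N, 2B`, then Hadamard gates on the
three coin wires (`CPreg 0`, `CPreg 1`, `τ`). [folklore] -/
def constCirc : QCircuit cliffordT Λ.Wd :=
  (⟨revCompile (toRevList Λ.constFin Λ.constFin_wf)⟩ : QCircuit cliffordT Λ.Wd).append
    ⟨[hOn (Λ.fin (Λ.CPreg 0 + 0)), hOn (Λ.fin (Λ.CPreg 0 + 1)), hOn (Λ.fin Λ.tau)]⟩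

/-- The preparation stage: `H` on `c`, controlled `H` on `X`, the flag. [cite: VanDamSeroussi2002, §4 Thm. 1 (proof)] -/
def prepCirc : QCircuit cliffordT Λ.Wd :=
  ((⟨[hOn (Λ.fin Λ.c)]⟩ : QCircuit cliffordT Λ.Wd).append ⟨chLayer (Λ.fin Λ.c) Λ.Xs Λ.c_ne_Xs⟩).append
    (PXor.circuit Λ.geom₁ (hN := Λ.Wd_pos))

/-- The repetition stage: `H` on `J`, `Y ^= x + jp`, `X ++ J ^= split Y`. [folklore] -/
def repCirc : QCircuit cliffordT Λ.Wd :=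
  ((⟨(List.range Λ.lam).map fun i => hOn (Λ.fin (Λ.J 0 + i))⟩ : QCircuit cliffordT Λ.Wd).append
    (PXor.circuit Λ.geom₂ (hN := Λ.Wd_pos))).append (PXor.circuit Λ.geom₃ (hN := Λ.Wd_pos))

/-- The eigenvalue measurement stage (Kitaev's circuit around `V`), as a circuit on `Wd` wires. [cite: Kitaev1995, §3] -/
def peCirc : QCircuit cliffordT Λ.Wd := kitaevCircuit (n := Λ.n₁) (k := Λ.k) (m := Λ.kap + Λ.kap) Λ.V Λ.σ

/-- The read-out stage of the control: `S†` controlled by the coin `τ` (sine test iff `τ = 1`), then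
`H`. [cite: VanDamSeroussi2002, §3.1 Fact 2] [cite: Kitaev1995, §3 Remark 8] -/
def readCirc : QCircuit cliffordT Λ.Wd :=
  (⟨csdWord (Λ.fin Λ.tau) (Λ.fin Λ.c) Λ.tau_ne_c⟩ : QCircuit cliffordT Λ.Wd).append ⟨[hOn (Λ.fin Λ.c)]⟩

/-- **The block circuit** (it depends on the sizes only: `p`, `r` are read off the input wires, the
coins are quantum). [cite: VanDamSeroussi2002, §4 Algorithm 1 and Thm. 1 (proof)] -/
def blockCirc : QCircuit cliffordT Λ.Wd :=
  Λ.constCirc.append (Λ.prepCirc.append (Λ.repCirc.append (Λ.peCirc.append Λ.readCirc)))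

/-- The block circuit is oracle-free. [folklore] -/
theorem blockCirc_isOracleFree : Λ.blockCirc.IsOracleFree := by
  refine isOracleFree_append (isOracleFree_append (fun g hg => revCompile_isOracleFree _ g hg) (fun g hg => ?_))
    (isOracleFree_append ?_ (isOracleFree_append ?_ (isOracleFree_append ?_ ?_)))
  · simp only [List.mem_cons, List.not_mem_nil, or_false] at hg
    rcases hg with rfl | rfl | rfl <;> exact hOn_isOracleFree _
  · refine isOracleFree_append (isOracleFree_append (fun g hg => ?_) (chLayer_isOracleFree _ _ _)) (PXor.circuit_isOracleFree _)
    rw [List.mem_singleton] at hg; subst hg; exact hOn_isOracleFree _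
  · refine isOracleFree_append (isOracleFree_append (fun g hg => ?_) (PXor.circuit_isOracleFree _)) (PXor.circuit_isOracleFree _)
    obtain ⟨i, -, rfl⟩ := List.mem_map.1 hg; exact hOn_isOracleFree _
  · exact kitaevCircuit_isOracleFree Λ.V_isOracleFree _
  · refine isOracleFree_append (csdWord_isOracleFree _ _ _) (fun g hg => ?_)
    rw [List.mem_singleton] at hg; subst hg; exact hOn_isOracleFree _

end Circuit

end Layout

end CubicBlock

end VanDamSeroussi

end Literature.Computability.Cryptography
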